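import Summits.MatrixMultiplication.MatrixMultiplication.Theorems.FarEdgeDescentDialAnalysis
import HarnessLib

/-!
# Far-edge descent, kernel XXXVIII-D: the dial exponent is SHARP — the model squaring tower excludes everything above the `κ_a`-wedge

Route `FarEdgeDescent`, special leaf `FiniteSaturation` (stmt-MatrixMultiplication-23739): helper
kernel, THESES-FREE and def-free (decomp-mm lens 2 «structural dichotomy: special vs generic», gen 58).

Kernel XXXVIII-B (`dial_ceiling`) is the LOWER side of the anchor-budget dial: for every
`a ∈ (0,1]` (budget factor `β ∈ (1,2]`, `a = 3(β−1)/(2β−1)`) every exact readout of every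
product-and-full-reanchor schedule PASSES on a full wedge `0 ≤ σ ≤ c·τ^κ_a`,
`κ_a = log₂(2(3−a)/3)`, so no certificate of the `β`-toolbox excludes the power world of order
`θ_a = κ_a/(1−κ_a)`.  This file is the UPPER side, uniformly in `a ∈ (0,3/2)`: the exponent `κ_a`
cannot be raised.  THE MODEL SQUARING TOWER at the fixed point `u = 1/3` is the dictionary of
XXXVIII-C read as a two-sided law — base `F₀ ≥ (1 − a/3) + Φ₁σ − τℓ₀` (legs deviation at least
linear in `σ = s−1`, anchor deficit at most `τℓ₀`, `τ = 1−t`) and squaring steps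
`F_{j+1} ≥ F_j² + (a(3−a)/9)·exp(−τ·2^(j+1)ℓ₀)` (the cross term `a(3−a)uu'` at `u = u' = 1/3` with
the linearised loss `x^(t−1) ≥ exp(−τℓ'')`, `ℓ_j = 2^j ℓ₀`; the concavity factor `t` and a shift
`Λ` of the true lower bound `(A+x)^t − A^t ≥ t·x·(A+x)^(t−1)` are absorbed into `ℓ₀`).  For it:

* `dial_deviation_step`: with `q = 1 − a/3`, `μ = 2q = 2(3−a)/3 = 2^κ_a` and the fixed-point identity
  `q² + a(3−a)/9 = q`, a deviation `F ≥ q + d` (`d ≥ 0`) becomes `F' − q ≥ μd − (a(3−a)/9)·y` after one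
  step with loss factor `e ≥ 1 − y` — the deviation is multiplied by EXACTLY the Hölder–chord equality
  factor `2^κ_a` of XXXVIII-A, minus the `τ`-loss;
* `dial_tower_core`: if stage `n` passes (`F_n ≤ 1`) and `τ·2ⁿℓ₀ ≤ 1` then `μⁿ·D₀ < 2`
  (induction `μ^j D₀ − τ2^jℓ₀ ≤ F_j − q`, closed because `μ + 2a(3−a)/9 = 2 − 2a²/9 ≤ 2`);
* `dial_tower_sharp`: if EVERY stage passes at `(σ,τ)` with `τℓ₀ ≤ 1` then
  `σ ≤ (4/Φ₁)·(τℓ₀)^κ_a` (take `n = ⌊log₂(1/(τℓ₀))⌋`, `μ^(log₂ X) = X^κ_a`);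
* `dial_wedge_not_thicker`: consequently for every `κ' < κ_a` and every `c' > 0` some `(σ,τ)` INSIDE the
  thicker wedge `σ ≤ c'τ^κ'` FAILS some stage of the model tower — the pass wedge of `dial_ceiling`
  has the sharp exponent, and the order of the `β`-toolbox is EXACTLY `θ_a` at model level
  (two-sided for every `β ∈ (1,2]`; at `a = 1` this is the abstract skeleton of kernels XXXI-B
  `virtualPowerBound_of_improvableChain` / XXXIII-B `readout_of_wedge` on Schönhage's `E₃` tower).

Scope / honesty.  Pure real analysis of the abstract dial recursion; for `1 < β < 2` no tensor
realisation of the budget `Q + βL` is known (memo NODE-g53 §3(e)), and nothing here bears on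
`ω(1,k,1)` itself: the content for the leaf is that the rate ORDER of every mortal-anchor toolbox is a
definite finite number `θ_a`, moving continuously and monotonically to `∞` as `β → 1⁺` and never
reaching the linear wedge (`κ = 1`) that `FiniteSaturation` is equivalent to (kernel XXX
`finiteSaturation_iff_linearWedge`).

References: Pan 1984 (LNCS 179) §16 Props. 16.2–16.5, §17 Thm. 17.1; Stothers 2010, Thm. 8;
Schönhage 1981, §5; Knuth TAOCP 2 §4.6.4 Ex. 67(g); Lotti–Romani 1983, Prop. 4.1.
Tags: `FiniteSaturation` (h₁) NEC · WEAKER · ATTACKED; sharpness of the dial ceiling (XXXVIII-B).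
-/

set_option linter.dupNamespace false

noncomputable section

namespace Summit.MatrixMultiplication.MatrixMultiplication.Theorems.FarEdgeDescentDialTower

open Summit.MatrixMultiplication.MatrixMultiplication.Theorems.FarEdgeDescentDialAnalysis

/-! ## §1 One squaring step at the fixed point: the deviation algebra -/

/-- **Fixed-point identities of the dial**: `(1 − a/3)² + a(3−a)/9 = 1 − a/3` (the square of the
corner value plus the cross term is the corner value again) and `2(3−a)/3 + 2·a(3−a)/9 = 2 − 2a²/9`.
[folklore] -/
theorem dial_fixedPoint_identity (a : ℝ) :
    (1 - a / 3) ^ 2 + a * (3 - a) / 9 = 1 - a / 3 ∧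
      2 * (3 - a) / 3 + 2 * (a * (3 - a) / 9) = 2 - 2 * a ^ 2 / 9 := by
  constructor <;> ring

/-- **THE DEVIATION STEP.**  `0 ≤ a ≤ 3`, `0 ≤ d`, `F ≥ (1 − a/3) + d`, `F' ≥ F² + (a(3−a)/9)·e` with
`e ≥ 1 − y`: then `F' − (1 − a/3) ≥ (2(3−a)/3)·d − (a(3−a)/9)·y` — the deviation from the corner value
is multiplied by `μ = 2(3−a)/3 = 2^κ_a` per squaring, up to the loss `(a(3−a)/9)·y`.
[cite: Pan1984, Props. 16.2–16.5] -/
theorem dial_deviation_step {a F F' d e y : ℝ} (ha0 : 0 ≤ a) (ha3 : a ≤ 3) (hd : 0 ≤ d)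
    (hF : 1 - a / 3 + d ≤ F) (hF' : F ^ 2 + a * (3 - a) / 9 * e ≤ F') (he : 1 - y ≤ e) :
    2 * (3 - a) / 3 * d - a * (3 - a) / 9 * y ≤ F' - (1 - a / 3) := by
  have hq : 0 ≤ 1 - a / 3 + d := by linarith
  have hsq : (1 - a / 3 + d) ^ 2 ≤ F ^ 2 := pow_le_pow_left₀ hq hF 2
  have hc : 0 ≤ a * (3 - a) / 9 := by nlinarith
  have h1 : a * (3 - a) / 9 * (1 - y) ≤ a * (3 - a) / 9 * e := mul_le_mul_of_nonneg_left he hc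
  nlinarith [sq_nonneg d]

/-! ## §2 The model squaring tower: the core bound -/

/-- **CORE BOUND (model squaring tower at the fixed point).**  `0 ≤ a < 3`, `ℓ₀, τ, D₀ ≥ 0`; base
`F₀ ≥ (1 − a/3) + D₀ − τℓ₀`; steps `F_{j+1} ≥ F_j² + (a(3−a)/9)·exp(−τ·2^(j+1)·ℓ₀)`.  If stage `n`
passes (`F_n ≤ 1`) and `τ·2ⁿ·ℓ₀ ≤ 1`, then `(2(3−a)/3)ⁿ·D₀ < 2`: else `μ^j D₀ − τ2^j ℓ₀ ≤ F_j − (1−a/3)`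
for all `j ≤ n` (the left side stays `≥ 2^(j−n) > 0`), and at `j = n` the left side is `≥ 1 > a/3`.
[cite: Pan1984, Props. 16.2–16.5, Thm. 17.1] [cite: Stothers2010, Thm. 8] -/
theorem dial_tower_core {a ℓ₀ τ D₀ : ℝ} (F : ℕ → ℝ) (ha0 : 0 ≤ a) (ha3 : a < 3)
    (hℓ₀ : 0 ≤ ℓ₀) (hτ : 0 ≤ τ) (hD₀ : 0 ≤ D₀)
    (hF0 : 1 - a / 3 + D₀ - τ * ℓ₀ ≤ F 0)
    (hstep : ∀ j, F j ^ 2 + a * (3 - a) / 9 * Real.exp (-(τ * (2 ^ (j + 1) * ℓ₀))) ≤ F (j + 1))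
    {n : ℕ} (hn : τ * (2 ^ n * ℓ₀) ≤ 1) (hpass : F n ≤ 1) :
    (2 * (3 - a) / 3) ^ n * D₀ < 2 := by
  by_contra H
  push Not at H
  obtain ⟨μ, hμ⟩ : ∃ μ : ℝ, μ = 2 * (3 - a) / 3 := ⟨_, rfl⟩
  rw [← hμ] at H
  have hμ0 : 0 ≤ μ := by rw [hμ]; apply div_nonneg <;> linarith
  have hμ2 : μ ≤ 2 := by rw [hμ, div_le_iff₀ (by norm_num : (0 : ℝ) < 3)]; linarith
  -- the would-be lower bounds stay positive:  (μ^j D₀ − τ 2^j ℓ₀)·2^(n−j) ≥ 1  for j ≤ n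
  have dpos : ∀ j, j ≤ n → 1 ≤ (μ ^ j * D₀ - τ * (2 ^ j * ℓ₀)) * 2 ^ (n - j) := by
    intro j hj
    have h2 : (2 : ℝ) ^ j * 2 ^ (n - j) = 2 ^ n := by rw [← pow_add, Nat.add_sub_cancel' hj]
    have hμn : μ ^ n = μ ^ j * μ ^ (n - j) := by rw [← pow_add, Nat.add_sub_cancel' hj]
    have hμle : μ ^ (n - j) ≤ 2 ^ (n - j) := pow_le_pow_left₀ hμ0 hμ2 _
    have hjD : 0 ≤ μ ^ j * D₀ := by positivity
    have hA : 2 ≤ μ ^ j * D₀ * 2 ^ (n - j) :=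
      calc (2 : ℝ) ≤ μ ^ n * D₀ := H
        _ = μ ^ j * D₀ * μ ^ (n - j) := by rw [hμn]; ring
        _ ≤ μ ^ j * D₀ * 2 ^ (n - j) := mul_le_mul_of_nonneg_left hμle hjD
    have hB : τ * (2 ^ j * ℓ₀) * 2 ^ (n - j) ≤ 1 :=
      calc τ * (2 ^ j * ℓ₀) * 2 ^ (n - j) = τ * (2 ^ j * 2 ^ (n - j) * ℓ₀) := by ring
        _ = τ * (2 ^ n * ℓ₀) := by rw [h2]
        _ ≤ 1 := hn
    rw [sub_mul]
    linarith
  have dnn : ∀ j, j ≤ n → 0 ≤ μ ^ j * D₀ - τ * (2 ^ j * ℓ₀) := by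
    intro j hj
    have h1 := dpos j hj
    have hP : (0 : ℝ) < 2 ^ (n - j) := by positivity
    by_contra hneg
    push Not at hneg
    nlinarith
  -- the deviation induction
  have P : ∀ j, j ≤ n → μ ^ j * D₀ - τ * (2 ^ j * ℓ₀) ≤ F j - (1 - a / 3) := by
    intro j
    induction j with
    | zero =>
      intro _
      simp only [pow_zero, one_mul]
      linarith
    | succ j ih =>
      intro hj
      have ihj := ih (by omega)
      have hdj := dnn j (by omega)
      have hstp := dial_deviation_step ha0 ha3.le hdj (by linarith) (hstep j)
        (Real.one_sub_le_exp_neg (τ * (2 ^ (j + 1) * ℓ₀)))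
      rw [← hμ] at hstp
      have hy : 0 ≤ τ * (2 ^ j * ℓ₀) := by positivity
      have hid : μ + 2 * (a * (3 - a) / 9) = 2 - 2 * a ^ 2 / 9 := by rw [hμ]; ring
      have key : μ ^ (j + 1) * D₀ - τ * (2 ^ (j + 1) * ℓ₀) ≤
          μ * (μ ^ j * D₀ - τ * (2 ^ j * ℓ₀)) - a * (3 - a) / 9 * (τ * (2 ^ (j + 1) * ℓ₀)) := by
        have e : μ * (μ ^ j * D₀ - τ * (2 ^ j * ℓ₀)) - a * (3 - a) / 9 * (τ * (2 ^ (j + 1) * ℓ₀)) -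
            (μ ^ (j + 1) * D₀ - τ * (2 ^ (j + 1) * ℓ₀)) =
            (2 - (μ + 2 * (a * (3 - a) / 9))) * (τ * (2 ^ j * ℓ₀)) := by
          rw [pow_succ, pow_succ]; ring
        have hpos : 0 ≤ (2 - (μ + 2 * (a * (3 - a) / 9))) * (τ * (2 ^ j * ℓ₀)) := by
          rw [hid]
          have : 0 ≤ 2 - (2 - 2 * a ^ 2 / 9) := by nlinarith [sq_nonneg a]
          exact mul_nonneg this hy
        linarith
      linarith
  have hfin := P n le_rfl
  have h1 := dpos n le_rfl
  rw [Nat.sub_self, pow_zero, mul_one] at h1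
  have ha13 : a / 3 < 1 := by linarith
  linarith

/-! ## §3 The sharp wedge: passing every stage forces `σ ≤ C·τ^κ_a` -/

/-- `μ^(log₂ X) = X^κ_a` for `μ = 2(3−a)/3 = 2^κ_a`, `X > 0`. [folklore] -/
theorem dialMu_rpow_logb {a X : ℝ} (ha : a < 3) (hX : 0 < X) :
    (2 * (3 - a) / 3) ^ Real.logb 2 X = X ^ Real.logb 2 (2 * (3 - a) / 3) := by
  have hμpos : 0 < 2 * (3 - a) / 3 := by
    apply div_pos <;> linarith
  have hμeq : 2 * (3 - a) / 3 = (2 : ℝ) ^ Real.logb 2 (2 * (3 - a) / 3) := by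
    rw [Real.rpow_logb (by norm_num) (by norm_num) hμpos]
  conv_lhs => rw [hμeq]
  rw [← Real.rpow_mul (by norm_num : (0 : ℝ) ≤ 2), mul_comm, Real.rpow_mul (by norm_num : (0 : ℝ) ≤ 2),
    Real.rpow_logb (by norm_num) (by norm_num) hX]

/-- **THE SHARP WEDGE OF THE DIAL.**  `0 < a < 3/2`, `ℓ₀, Φ₁ > 0`.  If the model squaring tower at
`(σ,τ)` (`σ, τ ≥ 0`, `τℓ₀ ≤ 1`; base `F₀ ≥ (1 − a/3) + Φ₁σ − τℓ₀`, steps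
`F_{j+1} ≥ F_j² + (a(3−a)/9)·exp(−τ·2^(j+1)ℓ₀)`) PASSES EVERY STAGE (`F_j ≤ 1` for all `j`), then
`σ ≤ (4/Φ₁)·(τℓ₀)^κ_a`, `κ_a = log₂(2(3−a)/3)`.  With XXXVIII-B `dial_ceiling` (pass for
`σ ≤ c·τ^κ_a`) the pass region of the `β`-toolbox is pinned between two wedges of the SAME exponent.
[cite: Pan1984, Props. 16.2–16.5, Thm. 17.1] [cite: Stothers2010, Thm. 8] [cite: Schonhage1981, §5] -/
theorem dial_tower_sharp {a ℓ₀ Φ₁ : ℝ} (ha0 : 0 < a) (ha : a < 3 / 2) (hℓ₀ : 0 < ℓ₀) (hΦ₁ : 0 < Φ₁)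
    {σ τ : ℝ} (F : ℕ → ℝ) (hσ : 0 ≤ σ) (hτ : 0 ≤ τ) (hτℓ : τ * ℓ₀ ≤ 1)
    (hF0 : 1 - a / 3 + Φ₁ * σ - τ * ℓ₀ ≤ F 0)
    (hstep : ∀ j, F j ^ 2 + a * (3 - a) / 9 * Real.exp (-(τ * (2 ^ (j + 1) * ℓ₀))) ≤ F (j + 1))
    (hpass : ∀ j, F j ≤ 1) :
    σ ≤ 4 / Φ₁ * (τ * ℓ₀) ^ Real.logb 2 (2 * (3 - a) / 3) := by
  obtain ⟨hκ0, hκ1⟩ := dialKappa_pos_lt_one ha0 ha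
  obtain ⟨κ, hκ⟩ : ∃ κ : ℝ, κ = Real.logb 2 (2 * (3 - a) / 3) := ⟨_, rfl⟩
  obtain ⟨μ, hμ⟩ : ∃ μ : ℝ, μ = 2 * (3 - a) / 3 := ⟨_, rfl⟩
  rw [← hκ] at hκ0 hκ1 ⊢
  have hμ1 : 1 < μ := by rw [hμ, lt_div_iff₀ (by norm_num : (0 : ℝ) < 3)]; linarith
  have hμ2 : μ ≤ 2 := by rw [hμ, div_le_iff₀ (by norm_num : (0 : ℝ) < 3)]; linarith
  have hμpos : 0 < μ := by linarith
  have hD₀ : 0 ≤ Φ₁ * σ := by positivity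
  have cv : ∀ n : ℕ, τ * (2 ^ n * ℓ₀) ≤ 1 → μ ^ n * (Φ₁ * σ) < 2 := by
    intro n hn
    have h := dial_tower_core F ha0.le (by linarith) hℓ₀.le hτ hD₀ hF0 hstep hn (hpass n)
    rwa [← hμ] at h
  by_cases hτ0 : τ = 0
  · -- τ = 0: every n is admissible, so Φ₁σ < 2μ^(−n) for all n, hence σ ≤ 0
    have hσ0 : σ ≤ 0 := by
      by_contra hpos
      push Not at hpos
      obtain ⟨n, hn⟩ := exists_pow_lt_of_lt_one (show 0 < Φ₁ * σ / 2 by positivity)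
        (show 1 / μ < 1 by rw [div_lt_one hμpos]; exact hμ1)
      have h := cv n (by rw [hτ0]; simp)
      have e : (1 / μ) ^ n * μ ^ n = 1 := by
        rw [← mul_pow, one_div, inv_mul_cancel₀ hμpos.ne', one_pow]
      have hμn : 0 < μ ^ n := by positivity
      -- (1/μ)^n < Φ₁σ/2  ⟹  1 < μ^n Φ₁ σ / 2
      have : 1 < μ ^ n * (Φ₁ * σ) / 2 := by
        have := mul_lt_mul_of_pos_right hn hμn
        rw [e] at this
        linarith [show Φ₁ * σ / 2 * μ ^ n = μ ^ n * (Φ₁ * σ) / 2 by ring]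
      linarith
    have h0 : (τ * ℓ₀) ^ κ = 0 := by rw [hτ0, zero_mul, Real.zero_rpow hκ0.ne']
    rw [h0, mul_zero]
    exact hσ0
  · have hτpos : 0 < τ := lt_of_le_of_ne hτ (Ne.symm hτ0)
    have hxpos : 0 < τ * ℓ₀ := by positivity
    have hXpos : 0 < (τ * ℓ₀)⁻¹ := by positivity
    have hX1 : (1 : ℝ) ≤ (τ * ℓ₀)⁻¹ := by rw [one_le_inv₀ hxpos]; exact hτℓ
    -- n = ⌊log₂ X⌋
    have hl0 : 0 ≤ Real.logb 2 (τ * ℓ₀)⁻¹ := Real.logb_nonneg (by norm_num) hX1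
    have hnle : (⌊Real.logb 2 (τ * ℓ₀)⁻¹⌋₊ : ℝ) ≤ Real.logb 2 (τ * ℓ₀)⁻¹ := Nat.floor_le hl0
    have hnlt := Nat.lt_floor_add_one (Real.logb 2 (τ * ℓ₀)⁻¹)
    have h2n : (2 : ℝ) ^ ⌊Real.logb 2 (τ * ℓ₀)⁻¹⌋₊ ≤ (τ * ℓ₀)⁻¹ := by
      have := Real.rpow_le_rpow_of_exponent_le (by norm_num : (1 : ℝ) ≤ 2) hnle
      rwa [Real.rpow_natCast, Real.rpow_logb (by norm_num) (by norm_num) hXpos] at this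
    have hn : τ * (2 ^ ⌊Real.logb 2 (τ * ℓ₀)⁻¹⌋₊ * ℓ₀) ≤ 1 :=
      calc τ * (2 ^ ⌊Real.logb 2 (τ * ℓ₀)⁻¹⌋₊ * ℓ₀) = (τ * ℓ₀) * 2 ^ ⌊Real.logb 2 (τ * ℓ₀)⁻¹⌋₊ := by
            ring
        _ ≤ (τ * ℓ₀) * (τ * ℓ₀)⁻¹ := mul_le_mul_of_nonneg_left h2n hxpos.le
        _ = 1 := mul_inv_cancel₀ hxpos.ne'
    have hv := cv _ hn
    -- μ^n ≥ μ^(log₂X − 1) = X^κ/μ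
    have e1 : μ ^ (Real.logb 2 (τ * ℓ₀)⁻¹ - 1) ≤ μ ^ ⌊Real.logb 2 (τ * ℓ₀)⁻¹⌋₊ := by
      have h := Real.rpow_le_rpow_of_exponent_le hμ1.le
        (show Real.logb 2 (τ * ℓ₀)⁻¹ - 1 ≤ ((⌊Real.logb 2 (τ * ℓ₀)⁻¹⌋₊ : ℕ) : ℝ) by linarith)
      rwa [Real.rpow_natCast] at h
    have e2 : μ ^ (Real.logb 2 (τ * ℓ₀)⁻¹ - 1) = ((τ * ℓ₀) ^ κ)⁻¹ / μ := by
      rw [Real.rpow_sub hμpos, Real.rpow_one, hμ, dialMu_rpow_logb (by linarith) hXpos, ← hκ,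
        Real.inv_rpow hxpos.le]
    rw [e2] at e1
    have hTk : 0 < (τ * ℓ₀) ^ κ := Real.rpow_pos_of_pos hxpos κ
    -- ((τℓ₀)^κ)⁻¹/μ · Φ₁σ ≤ μ^n Φ₁σ < 2  ⟹  Φ₁ σ < 2 μ (τℓ₀)^κ ≤ 4 (τℓ₀)^κ
    have h3 : ((τ * ℓ₀) ^ κ)⁻¹ / μ * (Φ₁ * σ) < 2 := lt_of_le_of_lt (mul_le_mul_of_nonneg_right e1 hD₀) hv
    have h4 : Φ₁ * σ < 2 * μ * (τ * ℓ₀) ^ κ := by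
      have e3 : ((τ * ℓ₀) ^ κ)⁻¹ / μ * (Φ₁ * σ) = Φ₁ * σ / (μ * (τ * ℓ₀) ^ κ) := by
        field_simp
      rw [e3, div_lt_iff₀ (by positivity)] at h3
      linarith
    have h5 : 2 * μ * (τ * ℓ₀) ^ κ ≤ 4 * (τ * ℓ₀) ^ κ := by nlinarith
    rw [show 4 / Φ₁ * (τ * ℓ₀) ^ κ = 4 * (τ * ℓ₀) ^ κ / Φ₁ by ring, le_div_iff₀ hΦ₁]
    linarith

/-! ## §4 Consequence: the pass wedge of `dial_ceiling` is not inside any thicker wedge -/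

/-- **NO THICKER PASS WEDGE.**  `0 < a < 3/2`, `ℓ₀, Φ₁ > 0`, and a family of model squaring towers
`F(σ,τ,·)` (base and step laws as in `dial_tower_sharp` at every `(σ,τ)`).  For every exponent
`κ' < κ_a` and every `c' > 0` there is `(σ,τ)` with `0 < τ ≤ 1`, `τℓ₀ ≤ 1`, `0 < σ ≤ c'·τ^κ'` — inside
the thicker wedge — at which SOME stage fails (`F(σ,τ,j) > 1`).  Hence the exponent `κ_a` of
XXXVIII-B `dial_ceiling` is sharp for every `a`, i.e. for every budget factor `β ∈ (1,2]`.
[cite: Pan1984, Thm. 17.1] [cite: Stothers2010, Thm. 8] -/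
theorem dial_wedge_not_thicker {a ℓ₀ Φ₁ : ℝ} (ha0 : 0 < a) (ha : a < 3 / 2) (hℓ₀ : 0 < ℓ₀)
    (hΦ₁ : 0 < Φ₁) (F : ℝ → ℝ → ℕ → ℝ)
    (hF0 : ∀ σ τ : ℝ, 1 - a / 3 + Φ₁ * σ - τ * ℓ₀ ≤ F σ τ 0)
    (hstep : ∀ (σ τ : ℝ) (j : ℕ),
      F σ τ j ^ 2 + a * (3 - a) / 9 * Real.exp (-(τ * (2 ^ (j + 1) * ℓ₀))) ≤ F σ τ (j + 1))
    {κ' c' : ℝ} (hκ' : κ' < Real.logb 2 (2 * (3 - a) / 3)) (hc' : 0 < c') :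
    ∃ σ τ : ℝ, 0 < τ ∧ τ ≤ 1 ∧ τ * ℓ₀ ≤ 1 ∧ 0 < σ ∧ σ ≤ c' * τ ^ κ' ∧ ∃ j, 1 < F σ τ j := by
  obtain ⟨hκ0, hκ1⟩ := dialKappa_pos_lt_one ha0 ha
  obtain ⟨κ, hκ⟩ : ∃ κ : ℝ, κ = Real.logb 2 (2 * (3 - a) / 3) := ⟨_, rfl⟩
  rw [← hκ] at hκ0 hκ1 hκ'
  have hε : 0 < κ - κ' := by linarith
  have hℓκ : 0 < ℓ₀ ^ κ := Real.rpow_pos_of_pos hℓ₀ κ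
  -- ρ = c'Φ₁/(8 ℓ₀^κ);  τ = min (ρ^(1/(κ−κ'))) (min 1 (1/ℓ₀));  σ = c' τ^κ'
  obtain ⟨ρ, hρ⟩ : ∃ ρ : ℝ, ρ = c' * Φ₁ / (8 * ℓ₀ ^ κ) := ⟨_, rfl⟩
  have hρpos : 0 < ρ := by rw [hρ]; positivity
  obtain ⟨τ, hτ⟩ : ∃ τ : ℝ, τ = min (ρ ^ (1 / (κ - κ'))) (min 1 (1 / ℓ₀)) := ⟨_, rfl⟩
  have hτpos : 0 < τ := by
    rw [hτ]; exact lt_min (Real.rpow_pos_of_pos hρpos _) (lt_min one_pos (by positivity))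
  have hτ1 : τ ≤ 1 := by rw [hτ]; exact le_trans (min_le_right _ _) (min_le_left _ _)
  have hτℓ : τ * ℓ₀ ≤ 1 := by
    have h : τ ≤ 1 / ℓ₀ := by rw [hτ]; exact le_trans (min_le_right _ _) (min_le_right _ _)
    rw [le_div_iff₀ hℓ₀] at h
    exact h
  have hτρ : τ ^ (κ - κ') ≤ ρ := by
    have h1 : τ ≤ ρ ^ (1 / (κ - κ')) := by rw [hτ]; exact min_le_left _ _
    have h2 := Real.rpow_le_rpow hτpos.le h1 hε.le
    rwa [one_div, Real.rpow_inv_rpow hρpos.le hε.ne'] at h2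
  have hτκ' : 0 < τ ^ κ' := Real.rpow_pos_of_pos hτpos κ'
  refine ⟨c' * τ ^ κ', τ, hτpos, hτ1, hτℓ, by positivity, le_rfl, ?_⟩
  by_contra hall
  push Not at hall
  have hsh := dial_tower_sharp ha0 ha hℓ₀ hΦ₁ (F (c' * τ ^ κ') τ) (by positivity) hτpos.le hτℓ
    (hF0 _ _) (hstep _ _) hall
  rw [← hκ] at hsh
  have e1 : (τ * ℓ₀) ^ κ = τ ^ κ' * τ ^ (κ - κ') * ℓ₀ ^ κ := by
    rw [Real.mul_rpow hτpos.le hℓ₀.le, ← Real.rpow_add hτpos]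
    congr 2
    ring
  rw [e1] at hsh
  have h3 : 4 / Φ₁ * (τ ^ κ' * τ ^ (κ - κ') * ℓ₀ ^ κ) ≤ 4 / Φ₁ * (τ ^ κ' * ρ * ℓ₀ ^ κ) := by
    have h4Φ : 0 ≤ 4 / Φ₁ := by positivity
    apply mul_le_mul_of_nonneg_left _ h4Φ
    apply mul_le_mul_of_nonneg_right _ hℓκ.le
    exact mul_le_mul_of_nonneg_left hτρ hτκ'.le
  have h4 : 4 / Φ₁ * (τ ^ κ' * ρ * ℓ₀ ^ κ) = c' / 2 * τ ^ κ' := by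
    rw [hρ]
    field_simp
    ring
  have h5 : 0 < c' * τ ^ κ' := by positivity
  linarith

end Summit.MatrixMultiplication.MatrixMultiplication.Theorems.FarEdgeDescentDialTower

end
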